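import Summits.NavierStokesRegularity.NavierStokesRegularity.Theses.SlicedKelvin
import Literature.Analysis.FluidPDE.AncientMildDrift
import Literature.Analysis.FluidPDE.KNSSLiouvilleBridge
import HarnessLib

/-!
# `PlanarFluxLiouville` is false without its joint-smoothness hypothesis (load-bearing analysis)

Negative-side support for the crux `SlicedKelvin.PlanarFluxLiouville`
(stmt-NavierStokesRegularity-15601, route `SlicedKelvin`), refuter crux-attack seat, 2026-08-17.

The crux concludes that every slice is constant EVERYWHERE (`∀ x, v t x = b`). The duality-form class
`IsBoundedAncientMildSolution` only sees slices up to null sets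
(`IsBoundedAncientMildSolution.congr_ae_slice`), and the tree's `curl` takes the junk value `0` at
points of non-differentiability; so the zero solution modified at a single point,
`Function.update 0 0 e₀`, is a bounded ancient mild solution with measurable slices and identically
vanishing `curl` — zero unsigned flux through every plane — which is constant on no slice
(`planarFluxLiouville_false_without_smooth`; the weakened statement is written INLINE: the crux
verbatim with `ContDiffOn ℝ ∞ (uncurry v) (Iio 0 ×ˢ univ)` dropped).

CONSEQUENCE (load-bearing analysis, D-0016 (a)): every proof of the crux must use the joint-smoothness
hypothesis (at least continuity of the slices), as the registered skeleton does in
`stub_irrotationalConstant`; without regularity the conclusion can only hold almost everywhere.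
This does NOT refute the crux as stated (its witness is excluded by `ContDiffOn`).
-/

noncomputable section

open Set MeasureTheory Filter Topology
open Literature.Analysis.FluidPDE

-- single-conjunct summit: `<Summit>.<Problem>` repeats the name (tree-wide convention, lakefile weak option)
set_option linter.dupNamespace false

namespace Summit.NavierStokesRegularity.NavierStokesRegularity.Theorems.PlanarFluxLiouville.Negative

/-- `curl u x = 0` whenever `fderiv ℝ u x = 0` (in particular at points of non-differentiability,
where `fderiv` is the junk value `0`). [folklore] -/
theorem curl_eq_zero_of_fderiv_eq_zero
    {u : EuclideanSpace ℝ (Fin 3) → EuclideanSpace ℝ (Fin 3)} {x : EuclideanSpace ℝ (Fin 3)}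
    (h : fderiv ℝ u x = 0) : curl u x = 0 := by
  unfold curl
  simp only [h, zero_apply, PiLp.zero_apply, sub_self]
  ext i
  fin_cases i <;> simp

/-- **`curl` of a point defect vanishes identically.** For `e : ℝ³`, the field
`Function.update 0 0 e` (zero away from the origin, `e` at the origin) has `curl ≡ 0`: away from
the origin it is locally zero; at the origin it is either zero (`e = 0`) or not continuous, hence
not differentiable, and `fderiv` is the junk value `0`. [folklore] -/
theorem curl_update_zero_eq_zero (e x : EuclideanSpace ℝ (Fin 3)) :
    curl (Function.update (fun _ : EuclideanSpace ℝ (Fin 3) => (0 : EuclideanSpace ℝ (Fin 3))) 0 e) x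
      = 0 := by
  set w : EuclideanSpace ℝ (Fin 3) → EuclideanSpace ℝ (Fin 3) :=
    Function.update (fun _ : EuclideanSpace ℝ (Fin 3) => (0 : EuclideanSpace ℝ (Fin 3))) 0 e with hw
  have hw_ne : ∀ {y : EuclideanSpace ℝ (Fin 3)}, y ≠ 0 → w y = 0 := fun hy =>
    Function.update_of_ne hy _ _
  have hw0 : w 0 = e := Function.update_self _ _ _
  apply curl_eq_zero_of_fderiv_eq_zero
  by_cases hx : x = 0
  · subst hx
    by_cases he : e = 0
    · -- then `w` is the zero field
      have hwz : w = fun _ => 0 := by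
        funext y
        by_cases hy : y = 0
        · subst hy; rw [hw0, he]
        · exact hw_ne hy
      rw [hwz]
      simp
    · apply fderiv_zero_of_not_differentiableAt
      intro hd
      have hc : ContinuousAt w (0 : EuclideanSpace ℝ (Fin 3)) := hd.continuousAt
      have h1 : Tendsto w (𝓝[≠] (0 : EuclideanSpace ℝ (Fin 3))) (𝓝 (w 0)) :=
        hc.tendsto.mono_left nhdsWithin_le_nhds
      have h2 : Tendsto w (𝓝[≠] (0 : EuclideanSpace ℝ (Fin 3))) (𝓝 0) := by
        refine tendsto_const_nhds.congr' ?_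
        exact eventually_nhdsWithin_of_forall fun y hy => (hw_ne hy).symm
      have h3 := tendsto_nhds_unique h1 h2
      rw [hw0] at h3
      exact he h3
  · have hev : w =ᶠ[𝓝 x] fun _ => (0 : EuclideanSpace ℝ (Fin 3)) := by
      have ho : IsOpen ({(0 : EuclideanSpace ℝ (Fin 3))}ᶜ : Set (EuclideanSpace ℝ (Fin 3))) :=
        isOpen_compl_singleton
      filter_upwards [ho.mem_nhds (by simpa using hx)] with y hy
      exact hw_ne hy
    rw [hev.fderiv_eq]
    simp

/-- **`PlanarFluxLiouville` is false without joint smoothness.** The negated statement (INLINE)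
is the crux `SlicedKelvin.PlanarFluxLiouville` verbatim with the hypothesis
`ContDiffOn ℝ (⊤ : ℕ∞) (Function.uncurry v) (Set.Iio 0 ×ˢ Set.univ)` dropped. Witness:
`v t = Function.update 0 0 e₀` for all `t` — a bounded ancient mild solution of the duality-form
class (a slice-wise null modification of the zero solution, `congr_ae_slice`), measurable slices,
`curl ≡ 0` hence zero flux through every plane (`M = 0`), yet no slice is constant. [folklore] -/
theorem planarFluxLiouville_false_without_smooth :
    ¬ (∀ (v : ℝ → EuclideanSpace ℝ (Fin 3) → EuclideanSpace ℝ (Fin 3)),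
        Literature.Analysis.FluidPDE.IsBoundedAncientMildSolution 1 v →
        (∀ t < 0, MeasureTheory.AEStronglyMeasurable (v t) MeasureTheory.volume) →
        (∃ M : ℝ, ∀ t < 0,
          ∀ (R : EuclideanSpace ℝ (Fin 3) ≃ₗᵢ[ℝ] EuclideanSpace ℝ (Fin 3)) (c : ℝ),
            ∫⁻ y : EuclideanSpace ℝ (Fin 2),
              ‖inner ℝ (Literature.Analysis.FluidPDE.curl (v t) (R (WithLp.toLp 2 ![y 0, y 1, c])))
                (R (EuclideanSpace.single 2 1))‖ₑ ≤ ENNReal.ofReal M) →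
        ∀ t < 0, ∃ b : EuclideanSpace ℝ (Fin 3), ∀ x, v t x = b) := by
  intro h
  -- the witness and its elementary properties
  set e : EuclideanSpace ℝ (Fin 3) := EuclideanSpace.single 0 1 with he
  set w : EuclideanSpace ℝ (Fin 3) → EuclideanSpace ℝ (Fin 3) :=
    Function.update (fun _ : EuclideanSpace ℝ (Fin 3) => (0 : EuclideanSpace ℝ (Fin 3))) 0 e with hw
  have he_ne : e ≠ 0 := by
    intro h0
    have := congrArg (fun z : EuclideanSpace ℝ (Fin 3) => z 0) h0
    simp [he] at this
  have hw_ne : ∀ {y : EuclideanSpace ℝ (Fin 3)}, y ≠ 0 → w y = 0 := fun hy =>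
    Function.update_of_ne hy _ _
  have hw0 : w 0 = e := Function.update_self _ _ _
  have hw_ae : w =ᵐ[volume] fun _ => (0 : EuclideanSpace ℝ (Fin 3)) := by
    have hm : ({(0 : EuclideanSpace ℝ (Fin 3))}ᶜ : Set (EuclideanSpace ℝ (Fin 3))) ∈
        ae (volume : Measure (EuclideanSpace ℝ (Fin 3))) :=
      compl_mem_ae_iff.2 (measure_singleton _)
    filter_upwards [hm] with y hy
    exact hw_ne hy
  have hw_bd : ∀ y, ‖w y‖ ≤ 1 := by
    intro y
    by_cases hy : y = 0
    · subst hy; rw [hw0]; simp [he]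
    · rw [hw_ne hy]; simp
  -- the four hypotheses of the weakened crux
  have hzero : IsBoundedAncientMildSolution 1
      (fun (_ : ℝ) (_ : EuclideanSpace ℝ (Fin 3)) => (0 : EuclideanSpace ℝ (Fin 3))) :=
    isBoundedAncientMildSolution_timeConst 1 (b := fun _ => (0 : EuclideanSpace ℝ (Fin 3)))
      ⟨0, fun _ _ => by simp⟩
  have hvsol : IsBoundedAncientMildSolution 1 (fun (_ : ℝ) => w) :=
    hzero.congr_ae_slice (fun _ _ => hw_ae) ⟨1, fun _ _ y => hw_bd y⟩
  have hmeas : ∀ t < 0, AEStronglyMeasurable ((fun (_ : ℝ) => w) t) volume := fun _ _ =>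
    (aestronglyMeasurable_const (b := (0 : EuclideanSpace ℝ (Fin 3)))).congr hw_ae.symm
  have hcurl : ∀ y, curl w y = 0 := fun y => by
    rw [hw]; exact curl_update_zero_eq_zero e y
  have hflux : ∃ M : ℝ, ∀ t < 0,
      ∀ (R : EuclideanSpace ℝ (Fin 3) ≃ₗᵢ[ℝ] EuclideanSpace ℝ (Fin 3)) (c : ℝ),
        ∫⁻ y : EuclideanSpace ℝ (Fin 2),
          ‖inner ℝ (curl ((fun (_ : ℝ) => w) t) (R (WithLp.toLp 2 ![y 0, y 1, c])))
            (R (EuclideanSpace.single 2 1))‖ₑ ≤ ENNReal.ofReal M :=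
    ⟨0, fun t _ R c => by simp only [hcurl]; simp⟩
  -- the conclusion fails on the slice `t = -1`
  obtain ⟨b, hb⟩ := h _ hvsol hmeas hflux (-1) (by norm_num)
  have h0 : w 0 = b := hb 0
  have h1 : w e = b := hb e
  rw [hw0] at h0
  rw [hw_ne he_ne] at h1
  exact he_ne (h0.trans h1.symm)

end Summit.NavierStokesRegularity.NavierStokesRegularity.Theorems.PlanarFluxLiouville.Negative

end
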